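import Summits.QuantumFields.BalabanUV.Beta.GAN24.CubicSectorLegPullback
import Summits.QuantumFields.BalabanUV.Beta.GAN24.ExitFaceCurrentCellTotals
import Summits.QuantumFields.BalabanUV.Beta.GAN24.BlockGaugeSummationByParts

/-!
# `BalabanUV.Beta.GAN24.ExitFaceCurrentDivBlockSum` — binder row G-an2-4 ∕ (CONV-C), W-slot CT-W, conservation law (C)∕(C)sym AT LEVELS `j + 1 ≥ 1`, the T2b ASSEMBLY STEP of this lineage's
# note `HOME/b2b-balaban-gan24-formalise-leaf-04/g68/EXIT-FACE-CURRENT-TOWER.md` §4 (A)(B): **THE DIVERGENCE OF THE LEVEL-`(j+1)` SLOT∕LEG-WEIGHTED CURRENT AT A COARSE SITE `y` IS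
# `cH_j ×` THE BLOCK SUM OVER `block(y)` OF THE SECOND-LEG LATTICE DIVERGENCE OF THE BI-WEIGHTED TABLE `v ↦ Σ'_t σ(t)·Σ'_w ρ(w)·(G_j ∘ vertexOfK G_j Lc S ν t)(Lc•w, v)(inr β, inl κ′)`**
# (the gauge letter `gaugeWt` summed by parts blockwise, the `t`- and `w`-sums pulled through the finite block sum, and the `(w,t)` order exchanged by dominated Fubini).

ONE MODULE, TWO PARTS (leaf-04 gen 70, 2026-08-23): Part A = gen 68's staged module T2a (namespace `…GAN24.ExitFaceCurrentDivStep`: `summable_leg_slotWeighted`,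
`div_faceSlot_current_eq`; never filed as a separate module) and Part B = gen 68's staged T2b assembly (namespace `…GAN24.ExitFaceCurrentDivBlockSum`), each a complete
`noncomputable section`, bytes of both bodies UNCHANGED from the twins certified together by gen 68's concat cert (rc 0, 0 sorry); merged only to shorten the gate's olean chain.

NOT IN PRINT; OUR BOOKKEEPING ([folklore] `tsum` bookkeeping BY NAME over this gen's T2a `ExitFaceCurrentDivStep.div_faceSlot_current_eq` and T2b-(iii)
`BlockGaugeSummationByParts.tsum_sum_mul_gaugeWt_eq_neg_blockSum_div`, an5∕an2's `ExpKernelCalculus.biLoc_comp_decays`, an2's `vertexFamily_vertexOfK` ∕ `decays_coDressKBmAt_KInvStep`;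
G-an2-4 formalisation swarm, leaf prover `b2b-balaban-gan24-formalise-leaf-04`, gen 68).  HONEST FRAMING (cell contract, verbatim): «discharging `BetaPertH` makes Bałaban's UV stability
UNCONDITIONAL — a real constructive-QFT result; it is NOT the continuum limit and NOT the Clay problem.»  HONEST DEPENDENCY (verbatim): «continuum YM on T⁴ ⇐ BetaPertH ∧ nine spine
estimates (0/9 proved); BetaPertH ⇐ (D1) ∧ (D4) ∧ CAP+tail; G-an2-4 gates asym, D1 and NE2/3/4.»

WHAT ([folklore]; generic `d`, in-block root `r ∈ box Lc`, `[NeZero Lc]`, `1 ≤ Lc`, every `j`, ANY local parity-odd table family `S` (`LocStencil S Cs δs`, `trK (S κ u) = −sgnK (S κ u)`),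
weights `|σ|, |ρ| ≤ 1`; 0 `def`, 0 cited facts, 0 `def … : Prop`, 0 sorry): §1 `exists_biLoc_compVertex` (ONE pair `(C, δ)` with `BiLoc (G_j ∘ vertexOfK G_j Lc S ν t) (Lc•t) (Lc•t) C δ`
for all `t`), `summable_slot_biLocFamily` (`t ↦ σ t·X_t x v a b` summable for such a family), `summable_leg_slot_biLocFamily` (the `(w,t)` pair family `ρ w·(σ t·X_t (Lc•w) v a b)` is
absolutely summable), `tsum_leg_slot_comm` (the `(w,t)` Fubini `Σ'_w ρ w·Σ'_t σ t·X_t(Lc•w,v) = Σ'_t σ t·Σ'_w ρ w·X_t(Lc•w,v)`); §2 **`div_faceSlot_current_eq_blockSum`**: with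
`X_t := G_j ∘ vertexOfK G_j Lc S ν t`, `G_j := coDressKBmAt (toSite r) Lc (KInvStep Lc j)` and `J(μ,y) := Σ' (t,w), σ t·ρ w·vertexOfK X̃♮_{j+1} Lc (unitS sf sm (e3OfK Lc G_j S)) ν t y w (inr β)(inl μ)`
(the current of `ExitFaceCurrentDivStep`),
`Σ_μ (J(μ,y) − J(μ,y−e_μ)) = cH_j·Σ_{r′∈box Lc} Σ_κ′ ((Σ'_t σ t·Σ'_w ρ w·X_t (Lc•w)(Lc•y + r′)(inr β)(inl κ′)) − (Σ'_t σ t·Σ'_w ρ w·X_t (Lc•w)(Lc•y + r′ − e_κ′)(inr β)(inl κ′)))`,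
`cH_j = (stepScale d Lc j·Lc^{d+1})⁻¹`.  The contraction of the `w`-sum into the field response (T2b-(i) `LegWeightedDressedRow` + `FaceDatumMultiplierResponse`) and the `(t,q)` exchange
(`SlotWeightedVertex`) are the NEXT step (note §4 (C)(D)).  Asserts NO value of Bałaban's tables; discharges
NOTHING of (C)sym ∕ (Q-D) ∕ (Q-D-rate) ∕ «T2Shape» ∕ «T2Drift» ∕ (hW, hWall); NEVER «G-an2-4 closed» as (CONV-C); NOT D1, NOT `BetaPertH`, NOT continuum, NOT Clay.
2026-08-23; no existing file touched.
-/

/-!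
# Part A — namespace `…GAN24.ExitFaceCurrentDivStep` (T2: the raw divergence identity; the per-slot brick `CubicSectorLegPullback.e3OfK_fstLeg_coarseDiv` pushed through the
# slot and leg sums)

WHAT ([folklore]; generic `d`, in-block root, `[NeZero Lc]`, every `j`, ANY local parity-odd table family `S` on the step-`j` lattice, bounded slot weight `σ` and leg weight `ρ`; 0 `def`,
0 cited facts, 0 `def … : Prop`, 0 sorry), `G_j = coDressKBmAt ρ Lc (KInvStep Lc j)`, `V = e3OfK Lc G_j S`, `cH_j = (stepScale d Lc j·Lc^{d+1})⁻¹`: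
§1 `summable_leg_slotWeighted` (the `w`-family `ρ(w)·Σ'_t σ(t)·V ν t z w f g` is summable); §2 **`div_faceSlot_current_eq`**:
`Σ_μ (J(μ, y) − J(μ, y − e_μ)) = −cH_j·Σ'_w ρ(w)·Σ'_t σ(t)·Σ'_v Σ_κ′ (G_j ∘ vertexOfK G_j Lc S ν t) (Lc•w) v (inr β) (inl κ′)·gaugeWt Lc y κ′ v`,
`J(μ, y) := Σ'_w ρ(w)·Σ'_t σ(t)·V ν t y w (inl μ) (inl β)`.  Asserts NO value of Bałaban's tables; discharges NOTHING of (C)sym ∕ (Q-D) ∕ (Q-D-rate) ∕ «T2Shape» ∕ «T2Drift» ∕ (hW, hWall);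
NEVER «G-an2-4 closed» as (CONV-C); NOT D1, NOT `BetaPertH`, NOT continuum, NOT Clay.  2026-08-23; no existing file touched.
-/

noncomputable section

open Finset
open scoped BigOperators
open Literature.MathematicalPhysics.QuantumFieldTheory
open Literature.MathematicalPhysics.QuantumFieldTheory.Balaban1983to89
open Literature.MathematicalPhysics.QuantumFieldTheory.Balaban1983to89.Beta
open ExpKernelCalculus (Site MKer comp Decays)
open AffineAveraging (box toSite)
open B6BondElimination (unitVec)
open OneStepResolventKernel (Fib LocStencil)
open OneStepKernelFamily (KInvStep vertexOfK)
open Summit.QuantumFields.BalabanUV.Beta.TameKernelCalculus (trK)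
open Summit.QuantumFields.BalabanUV.Beta.BorderedHessian (stepScale sgnK)
open Summit.QuantumFields.BalabanUV.Beta.AxialDressingRooted (coDressKBmAt decays_coDressKBmAt_KInvStep)
open Summit.QuantumFields.BalabanUV.Beta.KernelWardRelative (gaugeWt)
open Summit.QuantumFields.BalabanUV.Beta.SpineRooted (e3OfK locStencil_e3OfK)
open Summit.QuantumFields.BalabanUV.Beta.GAN24.CubicSectorLegPullback (e3OfK_fstLeg_coarseDiv)
open Summit.QuantumFields.BalabanUV.Beta.GAN24.ExitFaceCurrentCellTotals (summable_prod_slot_leg)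

namespace Summit.QuantumFields.BalabanUV.Beta.GAN24.ExitFaceCurrentDivStep

variable {d : ℕ} {Lc : ℕ} [NeZero Lc] {r : Fin (d + 1) → ℕ} {S : Fin (d + 1) → (Fin (d + 1) → ℤ) → MKer (d + 1) (Fib d)} {Cs δs : ℝ}

/-! ## §1 Summability of the slot-weighted leg family -/

omit [NeZero Lc] in
/-- [folklore] For a local stencil family `V` and bounded weights, `w ↦ ρ(w)·Σ'_t σ(t)·V ν t z w f g` is summable (dominated by the absolutely summable `(t,w)` family). -/
theorem summable_leg_slotWeighted {V : Fin (d + 1) → Site (d + 1) → MKer (d + 1) (Fib d)} {Cv δv : ℝ} (hV : LocStencil V Cv δv) (hδv : 0 < δv)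
    {σ ρ : Site (d + 1) → ℝ} (hσ : ∀ t, |σ t| ≤ 1) (hρ : ∀ w, |ρ w| ≤ 1) (ν : Fin (d + 1)) (z : Site (d + 1)) (f g : Fib d) :
    Summable fun w : Site (d + 1) => ρ w * ∑' t : Site (d + 1), σ t * V ν t z w f g := by
  have hs := summable_prod_slot_leg hV hδv ν z f g
  have hs' : Summable fun wt : Site (d + 1) × Site (d + 1) => |V ν wt.2 z wt.1 f g| :=
    ((Equiv.prodComm (Site (d + 1)) (Site (d + 1))).summable_iff.2 hs).congr fun wt => by simp
  have hw : Summable fun w : Site (d + 1) => ∑' t : Site (d + 1), |V ν t z w f g| := hs'.prod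
  refine Summable.of_norm_bounded hw (fun w => ?_)
  have hst : Summable fun t : Site (d + 1) => ‖σ t * V ν t z w f g‖ := by
    refine Summable.of_nonneg_of_le (fun _ => norm_nonneg _) (fun t => ?_) (hs'.prod_factor w)
    rw [Real.norm_eq_abs, abs_mul]
    calc |σ t| * |V ν t z w f g| ≤ 1 * |V ν t z w f g| := mul_le_mul_of_nonneg_right (hσ t) (abs_nonneg _)
      _ = _ := one_mul _
  have h1 : |∑' t : Site (d + 1), σ t * V ν t z w f g| ≤ ∑' t : Site (d + 1), |V ν t z w f g| := by
    have h := norm_tsum_le_tsum_norm hst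
    rw [Real.norm_eq_abs] at h
    refine h.trans (Summable.tsum_le_tsum (fun t => ?_) (hst) (hs'.prod_factor w))
    rw [Real.norm_eq_abs, abs_mul]
    calc |σ t| * |V ν t z w f g| ≤ 1 * |V ν t z w f g| := mul_le_mul_of_nonneg_right (hσ t) (abs_nonneg _)
      _ = _ := one_mul _
  rw [Real.norm_eq_abs, abs_mul]
  calc |ρ w| * |∑' t : Site (d + 1), σ t * V ν t z w f g| ≤ 1 * ∑' t : Site (d + 1), |V ν t z w f g| :=
        mul_le_mul (hρ w) h1 (abs_nonneg _) zero_le_one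
    _ = _ := one_mul _

/-! ## §2 The divergence of the face-slot current -/

/-- [folklore] **THE DIVERGENCE OF A SLOT-WEIGHTED, LEG-WEIGHTED CURRENT OF THE VALUE-FUNCTION CUBIC TABLE** (open FIRST leg; `S` local with parity-odd rows — every `SrecAt j`):
`Σ_μ (J(μ,y) − J(μ,y − e_μ)) = −cH_j·Σ'_w ρ(w)·Σ'_t σ(t)·Σ'_v Σ_κ′ (G_j ∘ vertexOfK G_j Lc S ν t) (Lc•w) v (inr β) (inl κ′)·gaugeWt Lc y κ′ v`,
`J(μ,y) = Σ'_w ρ(w)·Σ'_t σ(t)·e3OfK Lc G_j S ν t y w (inl μ)(inl β)` — the finite `Σ_μ` passes the two sums (§1), then `CubicSectorLegPullback.e3OfK_fstLeg_coarseDiv` per slot. -/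
theorem div_faceSlot_current_eq (hr : r ∈ box (d + 1) Lc) (j : ℕ) (hS : LocStencil S Cs δs) (hδs : 0 < δs) (hpar : ∀ κ u, trK (S κ u) = -sgnK (S κ u))
    {σ ρ : Site (d + 1) → ℝ} (hσ : ∀ t, |σ t| ≤ 1) (hρ : ∀ w, |ρ w| ≤ 1) (ν β : Fin (d + 1)) (y : Site (d + 1)) :
    ∑ μ : Fin (d + 1), ((∑' w : Site (d + 1), ρ w * ∑' t : Site (d + 1), σ t * e3OfK Lc (coDressKBmAt (toSite r) Lc (KInvStep (d := d) Lc j)) S ν t y w (Sum.inl μ) (Sum.inl β))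
        - ∑' w : Site (d + 1), ρ w * ∑' t : Site (d + 1), σ t * e3OfK Lc (coDressKBmAt (toSite r) Lc (KInvStep (d := d) Lc j)) S ν t (y - unitVec μ) w (Sum.inl μ) (Sum.inl β)) =
      -((stepScale d Lc j * (Lc : ℝ) ^ (d + 1))⁻¹ *
        ∑' w : Site (d + 1), ρ w * ∑' t : Site (d + 1), σ t *
          ∑' v : Site (d + 1), ∑ κ' : Fin (d + 1), comp (coDressKBmAt (toSite r) Lc (KInvStep (d := d) Lc j))
            (vertexOfK (coDressKBmAt (toSite r) Lc (KInvStep (d := d) Lc j)) Lc S ν t) ((Lc : ℤ) • w) v (Sum.inr β) (Sum.inl κ') * gaugeWt Lc y κ' v) := by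
  set G := coDressKBmAt (toSite r) Lc (KInvStep (d := d) Lc j) with hGdef
  set V := e3OfK Lc G S with hVdef
  have hLc : 1 ≤ Lc := Nat.one_le_iff_ne_zero.mpr (NeZero.ne Lc)
  obtain ⟨Cv, δv, hδv, hV⟩ := locStencil_e3OfK (N := Lc) hLc (decays_coDressKBmAt_KInvStep (d := d) hr j) hS hδs
  rw [← hGdef, ← hVdef] at hV
  -- summability of every `w`- and `t`-family involved
  have hsw : ∀ (z : Site (d + 1)) (μ : Fin (d + 1)), Summable fun w : Site (d + 1) => ρ w * ∑' t : Site (d + 1), σ t * V ν t z w (Sum.inl μ) (Sum.inl β) :=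
    fun z μ => summable_leg_slotWeighted hV hδv hσ hρ ν z _ _
  have hst : ∀ (z w : Site (d + 1)) (μ : Fin (d + 1)), Summable fun t : Site (d + 1) => σ t * V ν t z w (Sum.inl μ) (Sum.inl β) := by
    intro z w μ
    have hs := (summable_prod_slot_leg hV hδv ν z (Sum.inl μ) (Sum.inl β))
    have hs' : Summable fun wt : Site (d + 1) × Site (d + 1) => |V ν wt.2 z wt.1 (Sum.inl μ) (Sum.inl β)| :=
      ((Equiv.prodComm (Site (d + 1)) (Site (d + 1))).summable_iff.2 hs).congr fun wt => by simp
    refine Summable.of_norm_bounded (hs'.prod_factor w) (fun t => ?_)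
    rw [Real.norm_eq_abs, abs_mul]
    calc |σ t| * |V ν t z w (Sum.inl μ) (Sum.inl β)| ≤ 1 * |V ν t z w (Sum.inl μ) (Sum.inl β)| := mul_le_mul_of_nonneg_right (hσ t) (abs_nonneg _)
      _ = _ := one_mul _
  -- push the finite `Σ_μ` and the difference through the two sums
  have e1 : ∑ μ : Fin (d + 1), ((∑' w : Site (d + 1), ρ w * ∑' t : Site (d + 1), σ t * V ν t y w (Sum.inl μ) (Sum.inl β))
      - ∑' w : Site (d + 1), ρ w * ∑' t : Site (d + 1), σ t * V ν t (y - unitVec μ) w (Sum.inl μ) (Sum.inl β)) =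
      ∑' w : Site (d + 1), ρ w * ∑' t : Site (d + 1), σ t * ∑ μ : Fin (d + 1), (V ν t y w (Sum.inl μ) (Sum.inl β) - V ν t (y - unitVec μ) w (Sum.inl μ) (Sum.inl β)) := by
    rw [Finset.sum_congr rfl fun μ _ => ((hsw y μ).tsum_sub (hsw (y - unitVec μ) μ)).symm, ← Summable.tsum_finsetSum (fun μ _ => (hsw y μ).sub (hsw (y - unitVec μ) μ))]
    refine tsum_congr fun w => ?_
    rw [Finset.sum_congr rfl fun μ _ => (mul_sub (ρ w) _ _).symm, ← Finset.mul_sum]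
    congr 1
    rw [Finset.sum_congr rfl fun μ _ => ((hst y w μ).tsum_sub (hst (y - unitVec μ) w μ)).symm, ← Summable.tsum_finsetSum (fun μ _ => (hst y w μ).sub (hst (y - unitVec μ) w μ))]
    refine tsum_congr fun t => ?_
    rw [Finset.sum_congr rfl fun μ _ => (mul_sub (σ t) _ _).symm, ← Finset.mul_sum]
  rw [e1]
  -- per slot: the first-leg pull-back
  have e2 : ∀ (t w : Site (d + 1)), ∑ μ : Fin (d + 1), (V ν t y w (Sum.inl μ) (Sum.inl β) - V ν t (y - unitVec μ) w (Sum.inl μ) (Sum.inl β)) =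
      -((stepScale d Lc j * (Lc : ℝ) ^ (d + 1))⁻¹ *
        ∑' v : Site (d + 1), ∑ κ' : Fin (d + 1), comp G (vertexOfK G Lc S ν t) ((Lc : ℤ) • w) v (Sum.inr β) (Sum.inl κ') * gaugeWt Lc y κ' v) := by
    intro t w
    have h := e3OfK_fstLeg_coarseDiv hr j hS hδs hpar ν t y w β
    rw [← hGdef, ← hVdef] at h
    rw [← h, ← Finset.sum_neg_distrib]
    exact Finset.sum_congr rfl fun μ _ => by ring
  simp only [e2]
  -- collect the constant
  have e3 : ∀ w : Site (d + 1), ρ w * ∑' t : Site (d + 1), σ t * -((stepScale d Lc j * (Lc : ℝ) ^ (d + 1))⁻¹ *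
      ∑' v : Site (d + 1), ∑ κ' : Fin (d + 1), comp G (vertexOfK G Lc S ν t) ((Lc : ℤ) • w) v (Sum.inr β) (Sum.inl κ') * gaugeWt Lc y κ' v) =
      -((stepScale d Lc j * (Lc : ℝ) ^ (d + 1))⁻¹) * (ρ w * ∑' t : Site (d + 1), σ t *
        ∑' v : Site (d + 1), ∑ κ' : Fin (d + 1), comp G (vertexOfK G Lc S ν t) ((Lc : ℤ) • w) v (Sum.inr β) (Sum.inl κ') * gaugeWt Lc y κ' v) := by
    intro w
    rw [show (fun t : Site (d + 1) => σ t * -((stepScale d Lc j * (Lc : ℝ) ^ (d + 1))⁻¹ *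
        ∑' v : Site (d + 1), ∑ κ' : Fin (d + 1), comp G (vertexOfK G Lc S ν t) ((Lc : ℤ) • w) v (Sum.inr β) (Sum.inl κ') * gaugeWt Lc y κ' v)) =
        (fun t : Site (d + 1) => -((stepScale d Lc j * (Lc : ℝ) ^ (d + 1))⁻¹) * (σ t *
        ∑' v : Site (d + 1), ∑ κ' : Fin (d + 1), comp G (vertexOfK G Lc S ν t) ((Lc : ℤ) • w) v (Sum.inr β) (Sum.inl κ') * gaugeWt Lc y κ' v)) from
      funext fun t => by ring, tsum_mul_left]
    ring
  rw [tsum_congr e3, tsum_mul_left, neg_mul]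

end Summit.QuantumFields.BalabanUV.Beta.GAN24.ExitFaceCurrentDivStep

end

/-!
# Part B — namespace `…GAN24.ExitFaceCurrentDivBlockSum` (T2b assembly: the divergence as a block sum one level down)
-/

noncomputable section

open Finset
open scoped BigOperators
open Literature.MathematicalPhysics.QuantumFieldTheory
open Literature.MathematicalPhysics.QuantumFieldTheory.Balaban1983to89
open Literature.MathematicalPhysics.QuantumFieldTheory.Balaban1983to89.Beta
open B12Sec2to5 (l1 l1_nonneg)
open ExpKernelCalculus (Site MKer comp Decays BiLoc Zl Zl_nonneg exp_split summable_exp_shift summable_exp_shift' tsum_exp_shift tsum_exp_shift' l1_sub_symm biLoc_comp_decays)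
open AffineAveraging (box toSite)
open B6BondElimination (unitVec)
open OneStepResolventKernel (Fib LocStencil biLoc_mono decays_mono)
open OneStepKernelFamily (KInvStep vertexOfK colH vertexFamily_vertexOfK)
open Summit.QuantumFields.BalabanUV.Beta.TameKernelCalculus (trK)
open Summit.QuantumFields.BalabanUV.Beta.BorderedHessian (stepScale sgnK)
open Summit.QuantumFields.BalabanUV.Beta.AxialDressingRooted (coDressKBmAt decays_coDressKBmAt_KInvStep)
open Summit.QuantumFields.BalabanUV.Beta.BubbleParity (trK_coDressKBmAt_KInvStep)
open Summit.QuantumFields.BalabanUV.Beta.KernelWardRelative (gaugeWt)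
open Summit.QuantumFields.BalabanUV.Beta.SpineRooted (e3OfK)
open Summit.QuantumFields.BalabanUV.Beta.GAN24.ResolventLegCharges (summable_exp_coarse')
open Summit.QuantumFields.BalabanUV.Beta.GAN24.ExitFaceCurrentDivStep (div_faceSlot_current_eq)
open Summit.QuantumFields.BalabanUV.Beta.GAN24.BlockGaugeSummationByParts (tsum_sum_mul_gaugeWt_eq_neg_blockSum_div)

namespace Summit.QuantumFields.BalabanUV.Beta.GAN24.ExitFaceCurrentDivBlockSum

variable {d : ℕ} {Lc : ℕ} [NeZero Lc] {r : Fin (d + 1) → ℕ} {S : Fin (d + 1) → (Fin (d + 1) → ℤ) → MKer (d + 1) (Fib d)} {Cs δs : ℝ}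

/-! ## §1 One `BiLoc` for the dressed vertex family; the two summabilities; the `(w,t)` Fubini -/

/-- [folklore] **`G_j ∘ vertexOfK G_j Lc S ν t` IS BI-LOCALISED AT `(Lc•t, Lc•t)` UNIFORMLY IN `t`** (decay of `G_j`, `vertexFamily_vertexOfK`, `biLoc_comp_decays`). -/
theorem exists_biLoc_compVertex (hr : r ∈ box (d + 1) Lc) (j : ℕ) (hS : LocStencil S Cs δs) (hδs : 0 < δs) (ν : Fin (d + 1)) :
    ∃ C δ : ℝ, 0 < δ ∧ 0 ≤ C ∧ ∀ t : Site (d + 1), BiLoc (comp (coDressKBmAt (toSite r) Lc (KInvStep (d := d) Lc j))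
      (vertexOfK (coDressKBmAt (toSite r) Lc (KInvStep (d := d) Lc j)) Lc S ν t)) ((Lc : ℤ) • t) ((Lc : ℤ) • t) C δ := by
  obtain ⟨δK, CK, hδK, hCK, hG⟩ := decays_coDressKBmAt_KInvStep (d := d) hr j
  have hCs : 0 ≤ Cs := (hS 0 0).nonneg (Sum.inl 0)
  set m : ℝ := min δK δs with hm
  have hm0 : 0 < m := lt_min hδK hδs
  have hG1 : Decays (coDressKBmAt (toSite r) Lc (KInvStep (d := d) Lc j)) CK m := decays_mono hG hCK le_rfl (min_le_left _ _)
  have hS1 : LocStencil S Cs m := fun κ u => biLoc_mono (hS κ u) hCs (min_le_right _ _)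
  have hV := vertexFamily_vertexOfK (N := Lc) hG1 hCK hS1 hm0 le_rfl
  have hG2 : Decays (coDressKBmAt (toSite r) Lc (KInvStep (d := d) Lc j)) CK (m / 2) := decays_mono hG hCK le_rfl (by linarith [min_le_left δK δs])
  refine ⟨_, m / 4, by positivity, ?_, fun t => biLoc_comp_decays hG2 (hV ν t) (by positivity) (by linarith)⟩
  have := (biLoc_comp_decays hG2 (hV ν 0) (show (0 : ℝ) ≤ m / 4 by positivity) (by linarith)).nonneg (Sum.inl 0)
  exact this

/-- [folklore] For a family bi-localised at `(Lc•t, Lc•t)` uniformly in `t` and a bounded slot weight, `t ↦ σ t·X_t x v a b` is summable (any `x v`). -/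
theorem summable_slot_biLocFamily {X : Site (d + 1) → MKer (d + 1) (Fib d)} {C δ : ℝ} (hX : ∀ t, BiLoc (X t) ((Lc : ℤ) • t) ((Lc : ℤ) • t) C δ) (hδ : 0 < δ) (hC : 0 ≤ C)
    {σ : Site (d + 1) → ℝ} (hσ : ∀ t, |σ t| ≤ 1) (x v : Site (d + 1)) (a b : Fib d) :
    Summable fun t : Site (d + 1) => σ t * X t x v a b := by
  have hLc : 1 ≤ Lc := Nat.one_le_iff_ne_zero.mpr (NeZero.ne Lc)
  refine Summable.of_norm_bounded ((summable_exp_coarse' (d := d) hLc hδ v).mul_left C) (fun t => ?_)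
  rw [Real.norm_eq_abs, abs_mul]
  have h := hX t x v a b
  have h' : |X t x v a b| ≤ C * Real.exp (-δ * l1 (v - (Lc : ℤ) • t)) := by
    refine h.trans (mul_le_mul_of_nonneg_left (Real.exp_le_exp.2 ?_) hC)
    nlinarith [l1_nonneg (x - (Lc : ℤ) • t), l1_nonneg (v - (Lc : ℤ) • t)]
  calc |σ t| * |X t x v a b| ≤ 1 * (C * Real.exp (-δ * l1 (v - (Lc : ℤ) • t))) := mul_le_mul (hσ t) h' (abs_nonneg _) zero_le_one
    _ = _ := one_mul _

/-- [folklore] … and the `(w, t)` family `ρ w·σ t·X_t (Lc•w) v a b` is absolutely summable (bounded weights). -/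
theorem summable_leg_slot_biLocFamily {X : Site (d + 1) → MKer (d + 1) (Fib d)} {C δ : ℝ} (hX : ∀ t, BiLoc (X t) ((Lc : ℤ) • t) ((Lc : ℤ) • t) C δ) (hδ : 0 < δ)
    {σ ρ : Site (d + 1) → ℝ} (hσ : ∀ t, |σ t| ≤ 1) (hρ : ∀ w, |ρ w| ≤ 1) (v : Site (d + 1)) (a b : Fib d) :
    Summable fun wt : Site (d + 1) × Site (d + 1) => |ρ wt.1 * (σ wt.2 * X wt.2 ((Lc : ℤ) • wt.1) v a b)| := by
  have hLc : 1 ≤ Lc := Nat.one_le_iff_ne_zero.mpr (NeZero.ne Lc)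
  -- majorant `C·e^{−δ|Lc w − Lc t|}·e^{−δ|v − Lc t|}`
  have hMs : Summable fun wt : Site (d + 1) × Site (d + 1) => C * (Real.exp (-δ * l1 ((Lc : ℤ) • wt.1 - (Lc : ℤ) • wt.2)) * Real.exp (-δ * l1 (v - (Lc : ℤ) • wt.2))) := by
    refine Summable.mul_left C ?_
    have hs : Summable fun tw : Site (d + 1) × Site (d + 1) => Real.exp (-δ * l1 ((Lc : ℤ) • tw.2 - (Lc : ℤ) • tw.1)) * Real.exp (-δ * l1 (v - (Lc : ℤ) • tw.1)) := by
      refine (summable_prod_of_nonneg (fun tw => mul_nonneg (Real.exp_pos _).le (Real.exp_pos _).le)).2 ⟨fun t => ?_, ?_⟩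
      · show Summable fun w : Site (d + 1) => Real.exp (-δ * l1 ((Lc : ℤ) • w - (Lc : ℤ) • t)) * Real.exp (-δ * l1 (v - (Lc : ℤ) • t))
        have h := ((summable_exp_coarse' (d := d) hLc hδ ((Lc : ℤ) • t))).mul_right (Real.exp (-δ * l1 (v - (Lc : ℤ) • t)))
        exact h.congr fun w => by rw [l1_sub_symm]
      · have hb : ∀ t : Site (d + 1), ∑' w : Site (d + 1), Real.exp (-δ * l1 ((Lc : ℤ) • w - (Lc : ℤ) • t)) * Real.exp (-δ * l1 (v - (Lc : ℤ) • t)) ≤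
            Zl (d + 1) δ * Real.exp (-δ * l1 (v - (Lc : ℤ) • t)) := by
          intro t
          rw [tsum_mul_right]
          refine mul_le_mul_of_nonneg_right ?_ (Real.exp_pos _).le
          -- the coarse sum is dominated by the full lattice sum
          have hinj : Function.Injective (fun w : Site (d + 1) => (Lc : ℤ) • w) := by
            intro w w' h
            have hL : (Lc : ℤ) ≠ 0 := by exact_mod_cast NeZero.ne Lc
            funext i
            have hi := congrFun h i
            simp only [Pi.smul_apply, smul_eq_mul] at hi
            exact mul_left_cancel₀ hL hi
          have h1 : ∑' w : Site (d + 1), Real.exp (-δ * l1 ((Lc : ℤ) • w - (Lc : ℤ) • t)) ≤ ∑' y : Site (d + 1), Real.exp (-δ * l1 (y - (Lc : ℤ) • t)) :=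
            tsum_comp_le_tsum_of_inj (summable_exp_shift' hδ ((Lc : ℤ) • t)) (fun _ => (Real.exp_pos _).le) hinj
          rw [tsum_exp_shift'] at h1
          exact h1
        refine Summable.of_nonneg_of_le (fun t => tsum_nonneg fun w => mul_nonneg (Real.exp_pos _).le (Real.exp_pos _).le) hb ?_
        exact (summable_exp_coarse' (d := d) hLc hδ v).mul_left (Zl (d + 1) δ)
    exact ((Equiv.prodComm (Site (d + 1)) (Site (d + 1))).summable_iff.2 hs).congr fun wt => by simp
  refine Summable.of_nonneg_of_le (fun _ => abs_nonneg _) (fun wt => ?_) hMs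
  rw [abs_mul, abs_mul]
  have h := hX wt.2 ((Lc : ℤ) • wt.1) v a b
  calc |ρ wt.1| * (|σ wt.2| * |X wt.2 ((Lc : ℤ) • wt.1) v a b|) ≤ 1 * (1 * (C * Real.exp (-δ * (l1 ((Lc : ℤ) • wt.1 - (Lc : ℤ) • wt.2) + l1 (v - (Lc : ℤ) • wt.2))))) :=
        mul_le_mul (hρ wt.1) (mul_le_mul (hσ wt.2) h (abs_nonneg _) zero_le_one) (by positivity) zero_le_one
    _ = C * (Real.exp (-δ * l1 ((Lc : ℤ) • wt.1 - (Lc : ℤ) • wt.2)) * Real.exp (-δ * l1 (v - (Lc : ℤ) • wt.2))) := by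
        rw [one_mul, one_mul, mul_add, Real.exp_add]

/-- [folklore] **THE `(w,t)` FUBINI**: `Σ'_w ρ w·Σ'_t σ t·X_t (Lc•w) v a b = Σ'_t σ t·Σ'_w ρ w·X_t (Lc•w) v a b`. -/
theorem tsum_leg_slot_comm {X : Site (d + 1) → MKer (d + 1) (Fib d)} {C δ : ℝ} (hX : ∀ t, BiLoc (X t) ((Lc : ℤ) • t) ((Lc : ℤ) • t) C δ) (hδ : 0 < δ)
    {σ ρ : Site (d + 1) → ℝ} (hσ : ∀ t, |σ t| ≤ 1) (hρ : ∀ w, |ρ w| ≤ 1) (v : Site (d + 1)) (a b : Fib d) :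
    ∑' w : Site (d + 1), ρ w * ∑' t : Site (d + 1), σ t * X t ((Lc : ℤ) • w) v a b = ∑' t : Site (d + 1), σ t * ∑' w : Site (d + 1), ρ w * X t ((Lc : ℤ) • w) v a b := by
  have hs : Summable fun wt : Site (d + 1) × Site (d + 1) => ρ wt.1 * (σ wt.2 * X wt.2 ((Lc : ℤ) • wt.1) v a b) :=
    Summable.of_norm_bounded (summable_leg_slot_biLocFamily hX hδ hσ hρ v a b) (fun wt => by rw [Real.norm_eq_abs])
  have hs' : Summable fun tw : Site (d + 1) × Site (d + 1) => ρ tw.2 * (σ tw.1 * X tw.1 ((Lc : ℤ) • tw.2) v a b) :=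
    ((Equiv.prodComm (Site (d + 1)) (Site (d + 1))).summable_iff.2 hs).congr fun tw => by simp
  calc ∑' w : Site (d + 1), ρ w * ∑' t : Site (d + 1), σ t * X t ((Lc : ℤ) • w) v a b
      = ∑' w : Site (d + 1), ∑' t : Site (d + 1), ρ w * (σ t * X t ((Lc : ℤ) • w) v a b) := tsum_congr fun w => (tsum_mul_left).symm
    _ = ∑' wt : Site (d + 1) × Site (d + 1), ρ wt.1 * (σ wt.2 * X wt.2 ((Lc : ℤ) • wt.1) v a b) := (hs.tsum_prod).symm
    _ = ∑' tw : Site (d + 1) × Site (d + 1), ρ tw.2 * (σ tw.1 * X tw.1 ((Lc : ℤ) • tw.2) v a b) := by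
        rw [← (Equiv.prodComm (Site (d + 1)) (Site (d + 1))).tsum_eq (fun wt : Site (d + 1) × Site (d + 1) => ρ wt.1 * (σ wt.2 * X wt.2 ((Lc : ℤ) • wt.1) v a b))]
        exact tsum_congr fun tw => by simp [Equiv.prodComm_apply]
    _ = ∑' t : Site (d + 1), ∑' w : Site (d + 1), ρ w * (σ t * X t ((Lc : ℤ) • w) v a b) := hs'.tsum_prod
    _ = ∑' t : Site (d + 1), σ t * ∑' w : Site (d + 1), ρ w * X t ((Lc : ℤ) • w) v a b := by
        refine tsum_congr fun t => ?_
        rw [← tsum_mul_left]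
        exact tsum_congr fun w => by ring

/-! ## §2 The divergence as a block sum one level down -/

/-- [folklore] **THE DIVERGENCE OF THE LEVEL-`(j+1)` FACE-SLOT ∕ FACE-LEG CURRENT IS `−cH_j ×` THE BLOCK SUM OF THE SECOND-LEG DIVERGENCE OF A LEVEL-`j` CURRENT**
(`S` local with parity-odd rows; `|σ|, |ρ| ≤ 1`): with `X_t := G_j ∘ vertexOfK G_j Lc S ν t` and `t(v, κ′) := Σ'_t σ t·Σ'_w ρ w·X_t (Lc•w) v (inr β) (inl κ′)`,
`Σ_μ (J(μ,y) − J(μ,y−e_μ)) = cH_j·Σ_{r∈box Lc} Σ_κ′ (t (Lc•y + r, κ′) − t (Lc•y + r − e_κ′, κ′))` — T2a, then T2b-(iii) inside the two sums, then the finite block sum out, then the `(w,t)` Fubini. -/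
theorem div_faceSlot_current_eq_blockSum (hr : r ∈ box (d + 1) Lc) (j : ℕ) (hS : LocStencil S Cs δs) (hδs : 0 < δs) (hpar : ∀ κ u, trK (S κ u) = -sgnK (S κ u))
    {σ ρ : Site (d + 1) → ℝ} (hσ : ∀ t, |σ t| ≤ 1) (hρ : ∀ w, |ρ w| ≤ 1) (ν β : Fin (d + 1)) (y : Site (d + 1)) :
    ∑ μ : Fin (d + 1), ((∑' w : Site (d + 1), ρ w * ∑' t : Site (d + 1), σ t * e3OfK Lc (coDressKBmAt (toSite r) Lc (KInvStep (d := d) Lc j)) S ν t y w (Sum.inl μ) (Sum.inl β))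
        - ∑' w : Site (d + 1), ρ w * ∑' t : Site (d + 1), σ t * e3OfK Lc (coDressKBmAt (toSite r) Lc (KInvStep (d := d) Lc j)) S ν t (y - unitVec μ) w (Sum.inl μ) (Sum.inl β)) =
      (stepScale d Lc j * (Lc : ℝ) ^ (d + 1))⁻¹ *
        ∑ r' ∈ box (d + 1) Lc, ∑ κ' : Fin (d + 1),
          ((∑' t : Site (d + 1), σ t * ∑' w : Site (d + 1), ρ w * comp (coDressKBmAt (toSite r) Lc (KInvStep (d := d) Lc j))
              (vertexOfK (coDressKBmAt (toSite r) Lc (KInvStep (d := d) Lc j)) Lc S ν t) ((Lc : ℤ) • w) ((Lc : ℤ) • y + toSite r') (Sum.inr β) (Sum.inl κ'))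
          - (∑' t : Site (d + 1), σ t * ∑' w : Site (d + 1), ρ w * comp (coDressKBmAt (toSite r) Lc (KInvStep (d := d) Lc j))
              (vertexOfK (coDressKBmAt (toSite r) Lc (KInvStep (d := d) Lc j)) Lc S ν t) ((Lc : ℤ) • w) ((Lc : ℤ) • y + toSite r' - unitVec κ') (Sum.inr β) (Sum.inl κ'))) := by
  have hLc : 1 ≤ Lc := Nat.one_le_iff_ne_zero.mpr (NeZero.ne Lc)
  obtain ⟨C, δ, hδ, hC, hX⟩ := exists_biLoc_compVertex hr j hS hδs ν
  rw [div_faceSlot_current_eq hr j hS hδs hpar hσ hρ ν β y]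
  -- summation by parts inside, per `(w, t)`
  have e1 : ∀ (w t : Site (d + 1)), ∑' v : Site (d + 1), ∑ κ' : Fin (d + 1), (comp (coDressKBmAt (toSite r) Lc (KInvStep (d := d) Lc j)) (vertexOfK (coDressKBmAt (toSite r) Lc (KInvStep (d := d) Lc j)) Lc S ν t)) ((Lc : ℤ) • w) v (Sum.inr β) (Sum.inl κ') * gaugeWt Lc y κ' v =
      -∑ r' ∈ box (d + 1) Lc, ∑ κ' : Fin (d + 1), ((comp (coDressKBmAt (toSite r) Lc (KInvStep (d := d) Lc j)) (vertexOfK (coDressKBmAt (toSite r) Lc (KInvStep (d := d) Lc j)) Lc S ν t)) ((Lc : ℤ) • w) ((Lc : ℤ) • y + toSite r') (Sum.inr β) (Sum.inl κ')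
        - (comp (coDressKBmAt (toSite r) Lc (KInvStep (d := d) Lc j)) (vertexOfK (coDressKBmAt (toSite r) Lc (KInvStep (d := d) Lc j)) Lc S ν t)) ((Lc : ℤ) • w) ((Lc : ℤ) • y + toSite r' - unitVec κ') (Sum.inr β) (Sum.inl κ')) :=
    fun w t => tsum_sum_mul_gaugeWt_eq_neg_blockSum_div hLc (fun κ' v => (comp (coDressKBmAt (toSite r) Lc (KInvStep (d := d) Lc j)) (vertexOfK (coDressKBmAt (toSite r) Lc (KInvStep (d := d) Lc j)) Lc S ν t)) ((Lc : ℤ) • w) v (Sum.inr β) (Sum.inl κ')) y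
  simp only [e1]
  -- pull the finite block sum out of the two `tsum`s
  have hst : ∀ (w v : Site (d + 1)) (κ' : Fin (d + 1)), Summable fun t : Site (d + 1) => σ t * (comp (coDressKBmAt (toSite r) Lc (KInvStep (d := d) Lc j)) (vertexOfK (coDressKBmAt (toSite r) Lc (KInvStep (d := d) Lc j)) Lc S ν t)) ((Lc : ℤ) • w) v (Sum.inr β) (Sum.inl κ') :=
    fun w v κ' => summable_slot_biLocFamily hX hδ hC hσ _ v _ _
  have hsw : ∀ (v : Site (d + 1)) (κ' : Fin (d + 1)), Summable fun w : Site (d + 1) => ρ w * ∑' t : Site (d + 1), σ t * (comp (coDressKBmAt (toSite r) Lc (KInvStep (d := d) Lc j)) (vertexOfK (coDressKBmAt (toSite r) Lc (KInvStep (d := d) Lc j)) Lc S ν t)) ((Lc : ℤ) • w) v (Sum.inr β) (Sum.inl κ') := by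
    intro v κ'
    have hs := summable_leg_slot_biLocFamily hX hδ hσ hρ v (Sum.inr β) (Sum.inl κ')
    have hk : Summable fun w : Site (d + 1) => ∑' t : Site (d + 1), |ρ w * (σ t * (comp (coDressKBmAt (toSite r) Lc (KInvStep (d := d) Lc j)) (vertexOfK (coDressKBmAt (toSite r) Lc (KInvStep (d := d) Lc j)) Lc S ν t)) ((Lc : ℤ) • w) v (Sum.inr β) (Sum.inl κ'))| := hs.prod
    refine Summable.of_norm_bounded hk (fun w => ?_)
    rw [Real.norm_eq_abs, ← tsum_mul_left]
    have hst' : Summable fun t : Site (d + 1) => ‖ρ w * (σ t * (comp (coDressKBmAt (toSite r) Lc (KInvStep (d := d) Lc j)) (vertexOfK (coDressKBmAt (toSite r) Lc (KInvStep (d := d) Lc j)) Lc S ν t)) ((Lc : ℤ) • w) v (Sum.inr β) (Sum.inl κ'))‖ :=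
      (hs.prod_factor w).congr fun t => (Real.norm_eq_abs _).symm
    have h := norm_tsum_le_tsum_norm hst'
    simpa only [Real.norm_eq_abs] using h
  -- abbreviations for the two evaluation points
  set P : (Fin (d + 1) → ℕ) → Fin (d + 1) → Site (d + 1) := fun r' _ => (Lc : ℤ) • y + toSite r' with hP
  set Q : (Fin (d + 1) → ℕ) → Fin (d + 1) → Site (d + 1) := fun r' κ' => (Lc : ℤ) • y + toSite r' - unitVec κ' with hQ
  -- step 1: the `t`-sum through the finite block sum, per `w`
  have e2 : ∀ w : Site (d + 1), ∑' t : Site (d + 1), σ t * -∑ r' ∈ box (d + 1) Lc, ∑ κ' : Fin (d + 1),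
      ((comp (coDressKBmAt (toSite r) Lc (KInvStep (d := d) Lc j)) (vertexOfK (coDressKBmAt (toSite r) Lc (KInvStep (d := d) Lc j)) Lc S ν t)) ((Lc : ℤ) • w) (P r' κ') (Sum.inr β) (Sum.inl κ') - (comp (coDressKBmAt (toSite r) Lc (KInvStep (d := d) Lc j)) (vertexOfK (coDressKBmAt (toSite r) Lc (KInvStep (d := d) Lc j)) Lc S ν t)) ((Lc : ℤ) • w) (Q r' κ') (Sum.inr β) (Sum.inl κ')) =
      -∑ r' ∈ box (d + 1) Lc, ∑ κ' : Fin (d + 1), ((∑' t : Site (d + 1), σ t * (comp (coDressKBmAt (toSite r) Lc (KInvStep (d := d) Lc j)) (vertexOfK (coDressKBmAt (toSite r) Lc (KInvStep (d := d) Lc j)) Lc S ν t)) ((Lc : ℤ) • w) (P r' κ') (Sum.inr β) (Sum.inl κ'))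
        - ∑' t : Site (d + 1), σ t * (comp (coDressKBmAt (toSite r) Lc (KInvStep (d := d) Lc j)) (vertexOfK (coDressKBmAt (toSite r) Lc (KInvStep (d := d) Lc j)) Lc S ν t)) ((Lc : ℤ) • w) (Q r' κ') (Sum.inr β) (Sum.inl κ')) := by
    intro w
    have eg : ∀ t : Site (d + 1), σ t * -∑ r' ∈ box (d + 1) Lc, ∑ κ' : Fin (d + 1),
        ((comp (coDressKBmAt (toSite r) Lc (KInvStep (d := d) Lc j)) (vertexOfK (coDressKBmAt (toSite r) Lc (KInvStep (d := d) Lc j)) Lc S ν t)) ((Lc : ℤ) • w) (P r' κ') (Sum.inr β) (Sum.inl κ') - (comp (coDressKBmAt (toSite r) Lc (KInvStep (d := d) Lc j)) (vertexOfK (coDressKBmAt (toSite r) Lc (KInvStep (d := d) Lc j)) Lc S ν t)) ((Lc : ℤ) • w) (Q r' κ') (Sum.inr β) (Sum.inl κ')) =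
        -∑ r' ∈ box (d + 1) Lc, ∑ κ' : Fin (d + 1), (σ t * (comp (coDressKBmAt (toSite r) Lc (KInvStep (d := d) Lc j)) (vertexOfK (coDressKBmAt (toSite r) Lc (KInvStep (d := d) Lc j)) Lc S ν t)) ((Lc : ℤ) • w) (P r' κ') (Sum.inr β) (Sum.inl κ') - σ t * (comp (coDressKBmAt (toSite r) Lc (KInvStep (d := d) Lc j)) (vertexOfK (coDressKBmAt (toSite r) Lc (KInvStep (d := d) Lc j)) Lc S ν t)) ((Lc : ℤ) • w) (Q r' κ') (Sum.inr β) (Sum.inl κ')) := by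
      intro t
      rw [mul_neg, Finset.mul_sum]
      congr 1
      refine Finset.sum_congr rfl fun r' _ => ?_
      rw [Finset.mul_sum]
      exact Finset.sum_congr rfl fun κ' _ => mul_sub _ _ _
    rw [tsum_congr eg, tsum_neg]
    congr 1
    rw [Summable.tsum_finsetSum (fun r' _ => summable_sum fun κ' _ => (hst w _ κ').sub (hst w _ κ'))]
    refine Finset.sum_congr rfl fun r' _ => ?_
    rw [Summable.tsum_finsetSum (fun κ' _ => (hst w _ κ').sub (hst w _ κ'))]
    exact Finset.sum_congr rfl fun κ' _ => (hst w _ κ').tsum_sub (hst w _ κ')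
  rw [tsum_congr fun w => by rw [e2 w]]
  -- step 2: the `w`-sum through the finite block sum
  have e3 : ∑' w : Site (d + 1), ρ w * -∑ r' ∈ box (d + 1) Lc, ∑ κ' : Fin (d + 1),
      ((∑' t : Site (d + 1), σ t * (comp (coDressKBmAt (toSite r) Lc (KInvStep (d := d) Lc j)) (vertexOfK (coDressKBmAt (toSite r) Lc (KInvStep (d := d) Lc j)) Lc S ν t)) ((Lc : ℤ) • w) (P r' κ') (Sum.inr β) (Sum.inl κ')) - ∑' t : Site (d + 1), σ t * (comp (coDressKBmAt (toSite r) Lc (KInvStep (d := d) Lc j)) (vertexOfK (coDressKBmAt (toSite r) Lc (KInvStep (d := d) Lc j)) Lc S ν t)) ((Lc : ℤ) • w) (Q r' κ') (Sum.inr β) (Sum.inl κ')) =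
      -∑ r' ∈ box (d + 1) Lc, ∑ κ' : Fin (d + 1),
        ((∑' w : Site (d + 1), ρ w * ∑' t : Site (d + 1), σ t * (comp (coDressKBmAt (toSite r) Lc (KInvStep (d := d) Lc j)) (vertexOfK (coDressKBmAt (toSite r) Lc (KInvStep (d := d) Lc j)) Lc S ν t)) ((Lc : ℤ) • w) (P r' κ') (Sum.inr β) (Sum.inl κ'))
          - ∑' w : Site (d + 1), ρ w * ∑' t : Site (d + 1), σ t * (comp (coDressKBmAt (toSite r) Lc (KInvStep (d := d) Lc j)) (vertexOfK (coDressKBmAt (toSite r) Lc (KInvStep (d := d) Lc j)) Lc S ν t)) ((Lc : ℤ) • w) (Q r' κ') (Sum.inr β) (Sum.inl κ')) := by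
    have eg : ∀ w : Site (d + 1), ρ w * -∑ r' ∈ box (d + 1) Lc, ∑ κ' : Fin (d + 1),
        ((∑' t : Site (d + 1), σ t * (comp (coDressKBmAt (toSite r) Lc (KInvStep (d := d) Lc j)) (vertexOfK (coDressKBmAt (toSite r) Lc (KInvStep (d := d) Lc j)) Lc S ν t)) ((Lc : ℤ) • w) (P r' κ') (Sum.inr β) (Sum.inl κ')) - ∑' t : Site (d + 1), σ t * (comp (coDressKBmAt (toSite r) Lc (KInvStep (d := d) Lc j)) (vertexOfK (coDressKBmAt (toSite r) Lc (KInvStep (d := d) Lc j)) Lc S ν t)) ((Lc : ℤ) • w) (Q r' κ') (Sum.inr β) (Sum.inl κ')) =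
        -∑ r' ∈ box (d + 1) Lc, ∑ κ' : Fin (d + 1), (ρ w * (∑' t : Site (d + 1), σ t * (comp (coDressKBmAt (toSite r) Lc (KInvStep (d := d) Lc j)) (vertexOfK (coDressKBmAt (toSite r) Lc (KInvStep (d := d) Lc j)) Lc S ν t)) ((Lc : ℤ) • w) (P r' κ') (Sum.inr β) (Sum.inl κ'))
          - ρ w * ∑' t : Site (d + 1), σ t * (comp (coDressKBmAt (toSite r) Lc (KInvStep (d := d) Lc j)) (vertexOfK (coDressKBmAt (toSite r) Lc (KInvStep (d := d) Lc j)) Lc S ν t)) ((Lc : ℤ) • w) (Q r' κ') (Sum.inr β) (Sum.inl κ')) := by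
      intro w
      rw [mul_neg, Finset.mul_sum]
      congr 1
      refine Finset.sum_congr rfl fun r' _ => ?_
      rw [Finset.mul_sum]
      exact Finset.sum_congr rfl fun κ' _ => mul_sub _ _ _
    rw [tsum_congr eg, tsum_neg]
    congr 1
    rw [Summable.tsum_finsetSum (fun r' _ => summable_sum fun κ' _ => (hsw _ κ').sub (hsw _ κ'))]
    refine Finset.sum_congr rfl fun r' _ => ?_
    rw [Summable.tsum_finsetSum (fun κ' _ => (hsw _ κ').sub (hsw _ κ'))]
    exact Finset.sum_congr rfl fun κ' _ => (hsw _ κ').tsum_sub (hsw _ κ')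
  rw [e3]
  -- step 3: sign, and the `(w,t)` Fubini in each term
  simp only [mul_neg, neg_neg, tsum_leg_slot_comm hX hδ hσ hρ, hP, hQ]

end Summit.QuantumFields.BalabanUV.Beta.GAN24.ExitFaceCurrentDivBlockSum

end
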